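import Mathlib
import Literature.Analysis.FluidPDE.Tao2016AveragedNS.ShiftSetCascadeFlows
import Summits.NavierStokesRegularity.NavierStokesRegularity.Theorems.TaoLadderRungTwoFlatCertificateGlueFlowStepOn
import HarnessLib

/-!
# Certificate glue on a shift set `𝕊`, XIV-c: PER-COMPONENT WEIGHTS AND TIME-DEPENDENT HULLS — `StepCert` from an
  exact-flow step enclosure in a TUBE `u ↦ Tube u` between arbitrary start / landing predicates, plus a Grönwall
  allowance for the edge inputs measured with a weight table `ω : Fin m → ℤ → ℝ` (one weight PER WINDOW COMPONENT)
  (helper for items stmt-NavierStokesRegularity-22987 `FlatGapCertificatesV2` (crux K_A♭ of route TaoLadderRungTwoFlat)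
  and stmt-24295 K_A₂(64); cell harvest/h2-tao-ladder, p1 g15; theory-1 ruling R6a and referee finding A-66 (β))

Glue XIV / XIV-b (`stepCert_of_flowStep`, `stepCert_of_flowStep'`) fatten an exact-flow enclosure by the Grönwall
allowance `A·ω_k` with ONE weight per window SHELL and a CONSTANT hull box over the step. Two needs of the certificate
producers are not met by that shape (bus l.492 A-66 (β), l.494 R1/R6a): (i) the radii of a validated run differ by many
orders between the components of one shell and along the window (deep wake / front / quiet top), so the allowance must
follow a weight PROFILE PER COMPONENT `ω i k` — in the weighted sup metric `|y i k − y' i k| ≤ D·ω i k` this is a diagonal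
similarity of the window coordinates and costs nothing in the Grönwall argument; (ii) READOUT steps need the hull as tight
as the integrator's time-dependent enclosure (a priori boxes per sub-step, Taylor tubes), not one box for the whole step.

`stepCert_of_flowTube` delivers both: from
* `PFieldLipOn` — a weighted Lipschitz bound `K` of the truncated window field on a region `G = [glo, ghi]` for the
  per-component weights; `PInputDefectOn` — the input defect `δ·ω i k` on `G` with admissible edge inputs;
* an exact-flow step from every state of `Start ⊇ Node j`: a solution of the truncated system on `[0,h]` lying at each
  time `u` in `Tube u` (any family of predicates with `Tube u ⊆ G`) and ending in `Land`;
* `gronwallBound 0 K δ h ≤ A`, `G ⊇` the a priori `M`-box;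
it proves `StepCert j` with `Hull j ⊇ ⋃_{u ∈ [0,h]} (Tube u ⊕ A·ω)` and `Node (j+1) ⊇ Land ⊕ A·ω` (componentwise on the
window). Glue XIV-b is the special case `ω i k = ω k`, `Tube u = [Hlo, Hhi]`. Proof = glue XIV's (Mathlib
`dist_le_of_approx_trajectories_ODE_of_mem` in the coordinates `x_{ic} = y i k_c / ω i k_c`, sup norm).

Also: the per-component coordinate dictionary (`pwcoord`, `pwstate` and their lemmas) and the embeddings of the
per-shell notions (`fieldLipOn_perComp`, `inputDefectOn_perComp`).

HONEST FRAMING: Tao-type MODEL lattices (Tao 2016 §4/§6 vocabulary, shift-set parametrised); every enclosure / bound is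
a HYPOTHESIS — nothing is computed or certified here, no stub is closed, nothing about the Navier–Stokes equations.
-/

noncomputable section

-- the sub-problem namespace repeats the summit name by design (D-0017)
set_option linter.dupNamespace false

namespace Summit.NavierStokesRegularity.NavierStokesRegularity.Theorems

open Set Filter Topology Literature.Analysis.FluidPDE Literature.Analysis.FluidPDE.TaoCascade

namespace CertificateGlueOn

variable {m : ℕ}

/-! ### Per-component weighted Lipschitz and input-defect bounds -/

/-- **Weighted Lipschitz bound, per-component weights**: on the window box `[lo, hi]`, a weighted distance
`|Y − Y'| ≤ D·ω` (componentwise) is mapped by the truncated field to `≤ K·D·ω`.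
[cite: MooreKearfottCloud2009, §6.2–6.4 (interval enclosures of ranges); cell certificate format, box layer] -/
def PFieldLipOn (𝕊 : Finset (ℤ × ℤ × ℤ)) (ε₀ : ℝ) (α : Fin m → Fin m → Fin m → ℤ × ℤ × ℤ → ℝ)
    (Kb Ka : ℤ) (ω : Fin m → ℤ → ℝ) (lo hi : Fin m → ℤ → ℝ) (K : ℝ) : Prop :=
  ∀ (Y Y' : Fin m → ℤ → ℝ) (D : ℝ), 0 ≤ D → InBoxOn Kb Ka lo hi Y → InBoxOn Kb Ka lo hi Y' →
    (∀ i k, -Kb ≤ k → k ≤ Ka → |Y i k - Y' i k| ≤ D * ω i k) →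
      ∀ i k, -Kb ≤ k → k ≤ Ka →
        |truncField 𝕊 ε₀ α Kb Ka Y i k - truncField 𝕊 ε₀ α Kb Ka Y' i k| ≤ K * D * ω i k

/-- **Input-defect bound, per-component weights**: on the window box `[lo, hi]`, with admissible edge inputs, the
full field differs from the truncated one by at most `δ·ω i k`.
[cite: MooreKearfottCloud2009, §6.2–6.4 (interval enclosures of ranges); cell certificate format, box layer] -/
def PInputDefectOn (𝕊 : Finset (ℤ × ℤ × ℤ)) (ε₀ : ℝ) (α : Fin m → Fin m → Fin m → ℤ × ℤ × ℤ → ℝ)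
    (Kb Ka : ℤ) (Eb Et : ℝ) (ω : Fin m → ℤ → ℝ) (lo hi : Fin m → ℤ → ℝ) (δ : ℝ) : Prop :=
  ∀ Y : Fin m → ℤ → ℝ, InBoxOn Kb Ka lo hi Y → (∀ i, |Y i (-Kb - 1)| ≤ Eb) → (∀ i, |Y i (Ka + 1)| ≤ Et) →
    ∀ i k, -Kb ≤ k → k ≤ Ka →
      |quadTermOn 𝕊 ε₀ α (fun j n _ => Y j n) i k 0 - truncField 𝕊 ε₀ α Kb Ka Y i k| ≤ δ * ω i k

/-- The per-shell Lipschitz bound of glue XIV is the per-component one for the weight table `(i,k) ↦ ω k`. [folklore] -/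
theorem fieldLipOn_perComp {𝕊 : Finset (ℤ × ℤ × ℤ)} {ε₀ : ℝ} {α : Fin m → Fin m → Fin m → ℤ × ℤ × ℤ → ℝ}
    {Kb Ka : ℤ} {ω : ℤ → ℝ} {lo hi : Fin m → ℤ → ℝ} {K : ℝ} (h : FieldLipOn 𝕊 ε₀ α Kb Ka ω lo hi K) :
    PFieldLipOn 𝕊 ε₀ α Kb Ka (fun _ k => ω k) lo hi K := h

/-- The per-shell input defect of glue XIV is the per-component one for the weight table `(i,k) ↦ ω k`. [folklore] -/
theorem inputDefectOn_perComp {𝕊 : Finset (ℤ × ℤ × ℤ)} {ε₀ : ℝ}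
    {α : Fin m → Fin m → Fin m → ℤ × ℤ × ℤ → ℝ} {Kb Ka : ℤ} {Eb Et : ℝ} {ω : ℤ → ℝ} {lo hi : Fin m → ℤ → ℝ}
    {δ : ℝ} (h : InputDefectOn 𝕊 ε₀ α Kb Ka Eb Et ω lo hi δ) :
    PInputDefectOn 𝕊 ε₀ α Kb Ka Eb Et (fun _ k => ω k) lo hi δ := h

/-! ### Per-component weighted window coordinates -/

/-- Weighted window coordinates, per-component weights: `(i, c) ↦ Y i (shell c) / ω i (shell c)`. [folklore] -/
def pwcoord (Kb Ka : ℤ) (ω : Fin m → ℤ → ℝ) (Y : Fin m → ℤ → ℝ) : Fin m × Fin (winLen Kb Ka) → ℝ :=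
  fun c => Y c.1 (shellAt Kb c.2) / ω c.1 (shellAt Kb c.2)

/-- The state with given per-component weighted window coordinates (zero off the window). [folklore] -/
def pwstate (Kb Ka : ℤ) (ω : Fin m → ℤ → ℝ) (x : Fin m × Fin (winLen Kb Ka) → ℝ) : Fin m → ℤ → ℝ :=
  fun i k => if h : -Kb ≤ k ∧ k ≤ Ka then
    ω i k * x (i, ⟨(k + Kb).toNat, by
      unfold winLen
      rw [Int.toNat_lt_toNat (by omega)]
      omega⟩)
  else 0

variable {Kb Ka : ℤ} {ω : Fin m → ℤ → ℝ}

/-- `pwstate ∘ pwcoord` is the identity on the window. [folklore] -/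
theorem pwstate_pwcoord (hω : ∀ i k, 0 < ω i k) (Y : Fin m → ℤ → ℝ) (i : Fin m) {k : ℤ} (hk1 : -Kb ≤ k)
    (hk2 : k ≤ Ka) : pwstate Kb Ka ω (pwcoord Kb Ka ω Y) i k = Y i k := by
  unfold pwstate pwcoord shellAt
  rw [dif_pos ⟨hk1, hk2⟩]
  have e : (((k + Kb).toNat : ℕ) : ℤ) - Kb = k := by rw [Int.toNat_of_nonneg (by omega)]; ring
  simp only [e]
  field_simp [(hω i k).ne']

/-- Off the window `pwstate` vanishes. [folklore] -/
theorem pwstate_off (x : Fin m × Fin (winLen Kb Ka) → ℝ) (i : Fin m) {k : ℤ} (hk : ¬(-Kb ≤ k ∧ k ≤ Ka)) :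
    pwstate Kb Ka ω x i k = 0 := by
  unfold pwstate; rw [dif_neg hk]

/-- On the window `pwstate x` is the weight times the coordinate. [folklore] -/
theorem pwstate_on (x : Fin m × Fin (winLen Kb Ka) → ℝ) (hKK : 0 ≤ Ka + Kb + 1) (i : Fin m)
    (c : Fin (winLen Kb Ka)) : pwstate Kb Ka ω x i (shellAt Kb c) = ω i (shellAt Kb c) * x (i, c) := by
  obtain ⟨h1, h2⟩ := shellAt_mem hKK c
  unfold pwstate
  rw [dif_pos ⟨h1, h2⟩]
  congr 2
  rw [Prod.mk.injEq]
  exact ⟨rfl, Fin.ext (by simp [shellAt])⟩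

/-- `pwcoord ∘ pwstate` is the identity on coordinates. [folklore] -/
theorem pwcoord_pwstate (hω : ∀ i k, 0 < ω i k) (hKK : 0 ≤ Ka + Kb + 1)
    (xc : Fin m × Fin (winLen Kb Ka) → ℝ) : pwcoord Kb Ka ω (pwstate Kb Ka ω xc) = xc := by
  funext c
  unfold pwcoord
  rw [pwstate_on xc hKK c.1 c.2, mul_comm, mul_div_assoc, div_self (hω _ _).ne', mul_one]

/-- The truncated field of `pwstate (pwcoord Y)` is that of `Y`. [folklore] -/
theorem truncField_pwstate_pwcoord (𝕊 : Finset (ℤ × ℤ × ℤ)) (ε₀ : ℝ)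
    (α : Fin m → Fin m → Fin m → ℤ × ℤ × ℤ → ℝ) (hω : ∀ i k, 0 < ω i k) (Y : Fin m → ℤ → ℝ) :
    truncField 𝕊 ε₀ α Kb Ka (pwstate Kb Ka ω (pwcoord Kb Ka ω Y)) = truncField 𝕊 ε₀ α Kb Ka Y :=
  truncField_congr 𝕊 ε₀ α Kb Ka fun i _ hk1 hk2 => pwstate_pwcoord hω Y i hk1 hk2

/-- Componentwise weighted differences are bounded by the sup distance of the coordinates. [folklore] -/
theorem abs_pwstate_sub_le (hω : ∀ i k, 0 < ω i k) (hKK : 0 ≤ Ka + Kb + 1)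
    (x x' : Fin m × Fin (winLen Kb Ka) → ℝ) (i : Fin m) {k : ℤ} (hk1 : -Kb ≤ k) (hk2 : k ≤ Ka) :
    |pwstate Kb Ka ω x i k - pwstate Kb Ka ω x' i k| ≤ dist x x' * ω i k := by
  have hlt : (k + Kb).toNat < winLen Kb Ka := by
    unfold winLen; rw [Int.toNat_lt_toNat (by omega)]; omega
  set c : Fin (winLen Kb Ka) := ⟨(k + Kb).toNat, hlt⟩ with hc
  have hsh : shellAt Kb c = k := by
    simp only [shellAt, hc]; rw [Int.toNat_of_nonneg (by omega)]; ring
  have h1 := pwstate_on (ω := ω) x hKK i c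
  have h2 := pwstate_on (ω := ω) x' hKK i c
  rw [hsh] at h1 h2
  rw [h1, h2, ← mul_sub, abs_mul, abs_of_pos (hω i k), mul_comm]
  exact mul_le_mul_of_nonneg_right (by
    have := dist_le_pi_dist x x' (i, c)
    rwa [Real.dist_eq] at this) (hω i k).le

/-- A componentwise weighted bound on the window gives a sup-distance bound of the coordinates. [folklore] -/
theorem dist_pwcoord_le (hω : ∀ i k, 0 < ω i k) (hKK : 0 ≤ Ka + Kb + 1) {Y Y' : Fin m → ℤ → ℝ} {D : ℝ}
    (hD : 0 ≤ D) (h : ∀ i k, -Kb ≤ k → k ≤ Ka → |Y i k - Y' i k| ≤ D * ω i k) :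
    dist (pwcoord Kb Ka ω Y) (pwcoord Kb Ka ω Y') ≤ D := by
  refine (dist_pi_le_iff hD).2 fun c => ?_
  obtain ⟨h1, h2⟩ := shellAt_mem hKK c.2
  rw [Real.dist_eq]
  unfold pwcoord
  rw [← sub_div, abs_div, abs_of_pos (hω _ _), div_le_iff₀ (hω _ _)]
  exact h c.1 _ h1 h2

/-- Conversely, the sup distance of the coordinates bounds every weighted window difference. [folklore] -/
theorem abs_sub_le_dist_pwcoord (hω : ∀ i k, 0 < ω i k) (hKK : 0 ≤ Ka + Kb + 1) (Y Y' : Fin m → ℤ → ℝ)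
    (i : Fin m) {k : ℤ} (hk1 : -Kb ≤ k) (hk2 : k ≤ Ka) :
    |Y i k - Y' i k| ≤ dist (pwcoord Kb Ka ω Y) (pwcoord Kb Ka ω Y') * ω i k := by
  have h := abs_pwstate_sub_le hω hKK (pwcoord Kb Ka ω Y) (pwcoord Kb Ka ω Y') i hk1 hk2
  rwa [pwstate_pwcoord hω Y i hk1 hk2, pwstate_pwcoord hω Y' i hk1 hk2] at h

/-! ### The step theorem -/

variable {𝕊 : Finset (ℤ × ℤ × ℤ)} {ε₀ : ℝ} {α : Fin m → Fin m → Fin m → ℤ × ℤ × ℤ → ℝ} {Eb Et : ℝ}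

/-- **`StepCert` FROM AN EXACT-FLOW STEP IN A TIME-DEPENDENT TUBE PLUS A PER-COMPONENT GRÖNWALL ALLOWANCE FOR
THE INPUTS** (see the module docstring): `Hull j ⊇ ⋃_{u ∈ [0,h]} (Tube u ⊕ A·ω)`, `Node (j+1) ⊇ Land ⊕ A·ω`.
[cite: MooreKearfottCloud2009, §9–10 (interval enclosure of ODE solutions); cell certificate format, mesh layer] -/
theorem stepCert_of_flowTube (hKb : 0 ≤ Kb) (hKa : 1 ≤ Ka) (hω : ∀ i k, 0 < ω i k)
    {M : ℤ → ℝ} {t : ℕ → ℝ} {Node Hull : ℕ → (Fin m → ℤ → ℝ) → Prop} {j : ℕ}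
    {Start Land : (Fin m → ℤ → ℝ) → Prop} {Tube : ℝ → (Fin m → ℤ → ℝ) → Prop}
    {glo ghi : Fin m → ℤ → ℝ} {K δ A : ℝ} (hK : 0 ≤ K) (hδ : 0 ≤ δ)
    (hN : ∀ y, Node j y → Start y)
    (hGM : ∀ i k, -Kb ≤ k → k ≤ Ka → glo i k ≤ -M k ∧ M k ≤ ghi i k)
    (hGT : ∀ u ∈ Icc 0 (t (j + 1) - t j), ∀ p, Tube u p → InBoxOn Kb Ka glo ghi p)
    (hlip : PFieldLipOn 𝕊 ε₀ α Kb Ka ω glo ghi K) (hdef : PInputDefectOn 𝕊 ε₀ α Kb Ka Eb Et ω glo ghi δ)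
    (hflow : ∀ z : Fin m → ℤ → ℝ, Start z → ∃ ψ : Fin m → ℤ → ℝ → ℝ,
      (∀ i k, -Kb ≤ k → k ≤ Ka → ψ i k 0 = z i k) ∧
      (∀ i k, -Kb ≤ k → k ≤ Ka → ∀ u ∈ Icc 0 (t (j + 1) - t j),
        HasDerivWithinAt (ψ i k) (truncField 𝕊 ε₀ α Kb Ka (slice ψ u) i k) (Icc 0 (t (j + 1) - t j)) u) ∧
      (∀ u ∈ Icc 0 (t (j + 1) - t j), Tube u (slice ψ u)) ∧
      Land (slice ψ (t (j + 1) - t j)))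
    (hA : gronwallBound 0 K δ (t (j + 1) - t j) ≤ A)
    (hH : ∀ u ∈ Icc 0 (t (j + 1) - t j), ∀ y p : Fin m → ℤ → ℝ, Tube u p →
      (∀ i k, -Kb ≤ k → k ≤ Ka → |y i k - p i k| ≤ A * ω i k) → Hull j y)
    (hN' : ∀ y p : Fin m → ℤ → ℝ, Land p →
      (∀ i k, -Kb ≤ k → k ≤ Ka → |y i k - p i k| ≤ A * ω i k) → Node (j + 1) y) :
    StepCert 𝕊 ε₀ α Kb Ka Eb Et M t Node Hull j := by
  intro s S hs hsh hnode hrun hM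
  have hKK : 0 ≤ Ka + Kb + 1 := by omega
  set h := t (j + 1) - t j with hh
  obtain ⟨ψ, hψ0, hψd, hψT, hψN⟩ := hflow (slice S 0) (hN _ hnode)
  -- weighted coordinates of the run and of the exact solution
  set f : ℝ → (Fin m × Fin (winLen Kb Ka) → ℝ) := fun u => pwcoord Kb Ka ω (slice S u) with hf
  set g : ℝ → (Fin m × Fin (winLen Kb Ka) → ℝ) := fun u => pwcoord Kb Ka ω (slice ψ u) with hg
  set v : (Fin m × Fin (winLen Kb Ka) → ℝ) → (Fin m × Fin (winLen Kb Ka) → ℝ) :=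
    fun x => pwcoord Kb Ka ω (truncField 𝕊 ε₀ α Kb Ka (pwstate Kb Ka ω x)) with hv
  set T : Set (Fin m × Fin (winLen Kb Ka) → ℝ) := {x | InBoxOn Kb Ka glo ghi (pwstate Kb Ka ω x)} with hT
  -- Lipschitz bound of `v` on `T`
  have hvlip : LipschitzOnWith K.toNNReal v T := by
    refine LipschitzOnWith.of_dist_le_mul fun x hx x' hx' => ?_
    rw [Real.coe_toNNReal K hK]
    refine dist_pwcoord_le hω hKK (mul_nonneg hK dist_nonneg) fun i k hk1 hk2 => ?_
    have := hlip (pwstate Kb Ka ω x) (pwstate Kb Ka ω x') (dist x x') dist_nonneg hx hx'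
      (fun i' k' hk1' hk2' => abs_pwstate_sub_le hω hKK x x' i' hk1' hk2') i k hk1 hk2
    exact this
  -- the run: derivative, continuity, defect, region
  have hSd : ∀ u ∈ Ico 0 s, HasDerivWithinAt f
      (pwcoord Kb Ka ω (fun i k => quadTermOn 𝕊 ε₀ α S i k u)) (Ici u) u := by
    intro u hu
    have hmem : Icc 0 s ∈ 𝓝[≥] u := mem_of_superset (Icc_mem_nhdsGE hu.2) (Icc_subset_Icc_left hu.1)
    refine HasDerivWithinAt.mono_of_mem_nhdsWithin ?_ hmem
    rw [hasDerivWithinAt_pi]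
    intro c
    obtain ⟨h1, h2⟩ := shellAt_mem hKK c.2
    have := (hrun.deriv c.1 _ h1 h2 u (Ico_subset_Icc_self hu)).div_const (ω c.1 (shellAt Kb c.2))
    simpa [hf, pwcoord, slice] using this
  have hSc : ContinuousOn f (Icc 0 s) := by
    rw [continuousOn_pi]
    intro c
    obtain ⟨h1, h2⟩ := shellAt_mem hKK c.2
    simpa [hf, pwcoord, slice] using (hrun.continuousOn c.1 h1 h2).div_const (ω c.1 (shellAt Kb c.2))
  have hST : ∀ u ∈ Ico 0 s, f u ∈ T := by
    intro u hu i k hk1 hk2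
    simp only [hf]
    rw [pwstate_pwcoord hω _ i hk1 hk2, slice_apply]
    have hb := abs_le.mp (hM i k hk1 hk2 u (Ico_subset_Icc_self hu))
    have hg' := hGM i k hk1 hk2
    exact ⟨hg'.1.trans hb.1, hb.2.trans hg'.2⟩
  have hSdef : ∀ u ∈ Ico 0 s,
      dist (pwcoord Kb Ka ω (fun i k => quadTermOn 𝕊 ε₀ α S i k u)) (v (f u)) ≤ δ := by
    intro u hu
    have hu' := Ico_subset_Icc_self hu
    simp only [hv, hf]
    rw [truncField_pwstate_pwcoord 𝕊 ε₀ α hω]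
    refine dist_pwcoord_le hω hKK hδ fun i k hk1 hk2 => ?_
    have hY : InBoxOn Kb Ka glo ghi (slice S u) := fun i' k' hk1' hk2' => by
      have hb := abs_le.mp (hM i' k' hk1' hk2' u hu')
      have hg' := hGM i' k' hk1' hk2'
      simp only [slice_apply]
      exact ⟨hg'.1.trans hb.1, hb.2.trans hg'.2⟩
    have := hdef (slice S u) hY (fun i' => by simpa [slice] using hrun.bound_bot i' u hu')
      (fun i' => by simpa [slice] using hrun.bound_top i' u hu') i k hk1 hk2
    rwa [quadTermOn_slice] at this
  -- the exact solution: derivative, continuity, region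
  have hψd' : ∀ u ∈ Ico 0 s, HasDerivWithinAt g (v (g u)) (Ici u) u := by
    intro u hu
    have hus : u < h := lt_of_lt_of_le hu.2 hsh
    have hmem : Icc 0 h ∈ 𝓝[≥] u := mem_of_superset (Icc_mem_nhdsGE hus) (Icc_subset_Icc_left hu.1)
    refine HasDerivWithinAt.mono_of_mem_nhdsWithin ?_ hmem
    rw [hasDerivWithinAt_pi]
    intro c
    obtain ⟨h1, h2⟩ := shellAt_mem hKK c.2
    have := (hψd c.1 _ h1 h2 u ⟨hu.1, hus.le⟩).div_const (ω c.1 (shellAt Kb c.2))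
    simp only [hv, hg]
    rw [truncField_pwstate_pwcoord 𝕊 ε₀ α hω]
    simpa [pwcoord, slice] using this
  have hψc : ContinuousOn g (Icc 0 s) := by
    rw [continuousOn_pi]
    intro c
    obtain ⟨h1, h2⟩ := shellAt_mem hKK c.2
    have : ContinuousOn (ψ c.1 (shellAt Kb c.2)) (Icc 0 h) := fun u hu =>
      (hψd c.1 _ h1 h2 u hu).continuousWithinAt
    simpa [hg, pwcoord, slice] using
      (this.mono (Icc_subset_Icc_right hsh)).div_const (ω c.1 (shellAt Kb c.2))
  have hψT' : ∀ u ∈ Ico 0 s, g u ∈ T := by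
    intro u hu i k hk1 hk2
    simp only [hg]
    rw [pwstate_pwcoord hω _ i hk1 hk2]
    have hu' : u ∈ Icc 0 h := ⟨hu.1, (lt_of_lt_of_le hu.2 hsh).le⟩
    exact hGT u hu' _ (hψT u hu') i k hk1 hk2
  have hψdef : ∀ u ∈ Ico 0 s, dist (v (g u)) (v (g u)) ≤ 0 := fun u _ => by rw [dist_self]
  -- same start
  have h0 : dist (f 0) (g 0) ≤ 0 := by
    refine le_of_eq (dist_eq_zero.2 ?_)
    funext c
    obtain ⟨h1, h2⟩ := shellAt_mem hKK c.2
    simp only [hf, hg, pwcoord, slice_apply, hψ0 c.1 _ h1 h2]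
  -- Grönwall
  have hgr := dist_le_of_approx_trajectories_ODE_of_mem (v := fun _ => v) (s := fun _ => T)
    (fun u _ => hvlip) hSc hSd hSdef hST hψc hψd' hψdef hψT' h0
  -- componentwise extraction
  have hdev : ∀ u ∈ Icc 0 s, ∀ i k, -Kb ≤ k → k ≤ Ka → |S i k u - ψ i k u| ≤ A * ω i k := by
    intro u hu i k hk1 hk2
    have h1 := abs_sub_le_dist_pwcoord hω hKK (slice S u) (slice ψ u) i hk1 hk2
    simp only [slice_apply] at h1
    have h2 := hgr u hu
    rw [add_zero, sub_zero, Real.coe_toNNReal K hK] at h2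
    have h3 : gronwallBound 0 K δ u ≤ A :=
      (gronwallBound_mono hK hδ (hu.2.trans hsh)).trans hA
    calc |S i k u - ψ i k u| ≤ dist (f u) (g u) * ω i k := h1
      _ ≤ A * ω i k := mul_le_mul_of_nonneg_right (h2.trans h3) (hω i k).le
  refine ⟨fun u hu => hH u ⟨hu.1, hu.2.trans hsh⟩ _ (slice ψ u) (hψT u ⟨hu.1, hu.2.trans hsh⟩)
      fun i k hk1 hk2 => ?_, fun hsfull => hN' _ (slice ψ h) hψN fun i k hk1 hk2 => ?_⟩
  · simpa [slice_apply] using hdev u hu i k hk1 hk2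
  · have hd := hdev s ⟨hs.le, le_rfl⟩ i k hk1 hk2
    simpa [slice_apply, ← hsfull] using hd

/-- **Per-shell corollary with a tube**: glue XIV-b's weights `ω k` with the constant hull box replaced by a
time-dependent tube (for READOUT steps of certificates in the per-shell format).
[cite: MooreKearfottCloud2009, §9–10 (interval enclosure of ODE solutions); cell certificate format, mesh layer] -/
theorem stepCert_of_flowTube_shell (hKb : 0 ≤ Kb) (hKa : 1 ≤ Ka) {ω : ℤ → ℝ} (hω : ∀ k, 0 < ω k)
    {M : ℤ → ℝ} {t : ℕ → ℝ} {Node Hull : ℕ → (Fin m → ℤ → ℝ) → Prop} {j : ℕ}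
    {Start Land : (Fin m → ℤ → ℝ) → Prop} {Tube : ℝ → (Fin m → ℤ → ℝ) → Prop}
    {glo ghi : Fin m → ℤ → ℝ} {K δ A : ℝ} (hK : 0 ≤ K) (hδ : 0 ≤ δ)
    (hN : ∀ y, Node j y → Start y)
    (hGM : ∀ i k, -Kb ≤ k → k ≤ Ka → glo i k ≤ -M k ∧ M k ≤ ghi i k)
    (hGT : ∀ u ∈ Icc 0 (t (j + 1) - t j), ∀ p, Tube u p → InBoxOn Kb Ka glo ghi p)
    (hlip : FieldLipOn 𝕊 ε₀ α Kb Ka ω glo ghi K) (hdef : InputDefectOn 𝕊 ε₀ α Kb Ka Eb Et ω glo ghi δ)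
    (hflow : ∀ z : Fin m → ℤ → ℝ, Start z → ∃ ψ : Fin m → ℤ → ℝ → ℝ,
      (∀ i k, -Kb ≤ k → k ≤ Ka → ψ i k 0 = z i k) ∧
      (∀ i k, -Kb ≤ k → k ≤ Ka → ∀ u ∈ Icc 0 (t (j + 1) - t j),
        HasDerivWithinAt (ψ i k) (truncField 𝕊 ε₀ α Kb Ka (slice ψ u) i k) (Icc 0 (t (j + 1) - t j)) u) ∧
      (∀ u ∈ Icc 0 (t (j + 1) - t j), Tube u (slice ψ u)) ∧
      Land (slice ψ (t (j + 1) - t j)))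
    (hA : gronwallBound 0 K δ (t (j + 1) - t j) ≤ A)
    (hH : ∀ u ∈ Icc 0 (t (j + 1) - t j), ∀ y p : Fin m → ℤ → ℝ, Tube u p →
      (∀ i k, -Kb ≤ k → k ≤ Ka → |y i k - p i k| ≤ A * ω k) → Hull j y)
    (hN' : ∀ y p : Fin m → ℤ → ℝ, Land p →
      (∀ i k, -Kb ≤ k → k ≤ Ka → |y i k - p i k| ≤ A * ω k) → Node (j + 1) y) :
    StepCert 𝕊 ε₀ α Kb Ka Eb Et M t Node Hull j :=
  stepCert_of_flowTube (ω := fun _ k => ω k) hKb hKa (fun _ k => hω k) hK hδ hN hGM hGT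
    (fieldLipOn_perComp hlip) (inputDefectOn_perComp hdef) hflow hA hH hN'

end CertificateGlueOn

end Summit.NavierStokesRegularity.NavierStokesRegularity.Theorems

end
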